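import Summits.ABC.IUTFork.Repair.RHHullCellSlice
import HarnessLib

/-!
# R-H ROUND 3 (C-ii) SLACK-LAW, kernel companion — `RHHullCellSlackSum`: above the slice boundary the exact cell's PRICE is LINEAR in the label
# and sums to a QUADRATIC, the DEMAND is QUADRATIC and sums to a CUBIC — closed forms and the two-sided sandwich, in integers

PROOF-ONLY file (0 definitions, 0 `Prop` facts) of the abc-iut cell (D-0079 RESCUE sub-cell R-H, rung LADDER-ABC:A2.RESCUE.H; ROUND 3
`plan/rescue/R-H/ROUND3/START-HERE.md` v1.0 §1 row «rh-typ-3 successor (GO rh-typ-3 SLACK-LAW)»; seat abc-iut-rh-typ-3 gen 6). TAKES NO SIDE on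
[IUTchIII] Cor. 3.12 or on any author; nothing here asserts abc; the cell `RH.DiffPricedHull.HullCellδ e m j δ r_in r_out` (row 4's exact U2 cell with the
different exponent as a parameter, abc-iut-lens-transfer-3 / rp-d3; `δ = e − 1`: abc-iut-rh-typ-4's `HullCell`) is a CONJECTURED column formula of OUR typed
hull, and every statement below is integer arithmetic about it. COMPLEMENT (announced split 2026-08-27T01:42Z) of abc-iut-rh2-tab-2's per-cell file
`RHHullCellSlackLaw.lean` (deficit identity, first/second differences, monotonicity above a failing label): THIS file carries the SUMMED law. Inputs BY
NAME: abc-iut-rh2-w-2's ledger form `RH.HullCellSlice.hullCellδ_iff_demand_le_price` and `gain_bounds` (p480472).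

CURRENCY (MIN-SLICE §(i)/(i-w2).1, R-W WINDOW-TABLE `margin_U2cell`): at a bad place `w` with `e = e_w`, `m = m_q(w)`, `δ = δ_w` (different exponent),
`G := r_in − r_out ≥ 0` (log-shell span), label `j`: DEMAND `d_j := (j² − 1)·m`; PRICE `price_j := j·δ + (j+1)·G + ρ_j`, `ρ_j := (j²m − jδ − (j+1)r_in) mod e
∈ [0, e−1]`; the cell holds iff `d_j ≤ price_j`; DEFICIT `def_j := d_j − price_j` (`> 0` exactly off the slice). Labels above a label `J` are written
`j = J + 1 + k`, `k < n` (so the range is `J+1, …, L` with `L = J + n`; read `L = l⋆`).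
WHAT IS PROVED (namespace `Summit.ABC.IUTFork.Repair.RH.HullCellSlackSum`):
* §1 per cell: `not_hullCellδ_iff_price_lt_demand`; **`price_le_linear`** `price_j ≤ (δ + 2G + (e−1))·j` and **`linear_le_price`** `(δ + G)·j + G ≤ price_j`
  (`j ≥ 1`, `G ≥ 0`, `0 < e`) — the price is LINEAR in the label, both sides (rh3-ref-1's signed (C-ii) sentence 2026-08-27T01:23:49Z «c_j = price_j/d_j
  hyperbolic ≈ j⋆/j, never a cliff; price LINEAR, demand QUADRATIC»);
* §2 sums above `J` (`J ≥ 0`): **`two_mul_sum_labels_eq`** `2·Σ_{k<n} (J+1+k) = n·(2J+n+1)`; **`six_mul_sum_demand_eq`**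
  `6·Σ_{k<n} ((J+1+k)² − 1)·m = m·((J+n)(J+n−1)(2(J+n)+5) − J(J−1)(2J+5))` (`= 6m·(S(L) − S(J))`, `S` = abc-iut-rh2-w-1's `sum_range_sqSubOne`);
  **`two_mul_sum_price_le`** `2·Σ price ≤ (δ + 2G + e − 1)·n(2J+n+1)` and **`sum_price_ge`** `(δ + G)·n(2J+n+1) + 2G·n ≤ 2·Σ price` — the summed
  price is a QUADRATIC in `L = J+n` (triangle numbers), both sides; **`six_mul_sum_deficit_ge`** `6·Σ def ≥ m·(cubic) − 3(δ + 2G + e − 1)·n(2J+n+1)`.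
* §3 READING (docstrings; no new objects): a hypothetical «full-price per-label credit object» (one that certifies, at every cell above the boundary, the
  part `price_j` of the demand the hull inequality would still cover) recovers at most `3(δ+2G+e−1)·n(2J+n+1) / (m·[(J+n)(J+n−1)(2(J+n)+5) − J(J−1)(2J+5)])`
  of the conceded demand — `O((δ+G)/(m·l⋆)) = O(j⋆/l⋆)`, ref-1's `π₄/(1−μ₄) ≈ 1.5·f` law as a kernel UPPER BOUND: it never drives `μ → 1` at a deep place
  (`m ≫ δ + G`); recovering the `j²`-mass needs a credit growing like `j²` at the top labels (MIN-SLICE §(v-3)).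
* §4 sanity row by `decide`: HEX `λ₈ @ l = 11`, `p = 7` (`e = 165`, `m = 120`, `δ = 164`, `r_in = 28`, `r_out = −281`, boundary `J = 4`): at `j = 5`,
  `price = 2706`, `demand = 2880`, `deficit = 174` (R-W margin `−174`, rh2-w-2 `rows_worked_example`).
HONEST FRAMING: integer identities/inequalities about OUR typed cell; computed ≠ proved elsewhere, here proved; typed ≠ proved for every IUT locution;
refuted-as-typed ≠ refuted-in-print. [cite: Mochizuki2012, IUTchIII Cor. 3.12 Step (xi-f) p. 184; IUTchIV Prop. 1.2 (i)(ii) p. 10, Prop. 1.4 p. 13]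
[cite: SerreLocalFields1979, Ch. III §6 Prop. 13] [cite: DupuyHilado2025, §3.4, §4.9, §4.12] [claim: Mochizuki2012, status: disputed]
-/

namespace Summit.ABC.IUTFork.Repair.RH.HullCellSlackSum

open Finset
open Summit.ABC.IUTFork.Repair.RH.DiffPricedHull Summit.ABC.IUTFork.Repair.RH.HullCellSlice

/-! ## §1. Per cell: off the slice iff price < demand; the price is LINEAR in the label (both sides) -/

/-- **Off the slice ⟺ the price falls short of the demand** (`(j²−1)·m > j·δ + (j+1)·(r_in − r_out) + ρ_j`; rh2-w-2's ledger form negated).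
[folklore] -/
theorem not_hullCellδ_iff_price_lt_demand (e m j δ rin rout : ℤ) :
    ¬ HullCellδ e m j δ rin rout ↔
      j * δ + (j + 1) * (rin - rout) + (j ^ 2 * m - j * δ - (j + 1) * rin) % e < (j ^ 2 - 1) * m := by
  rw [hullCellδ_iff_demand_le_price, not_le]

/-- **The price is at most linear in the label**: `price_j ≤ (δ + 2(r_in − r_out) + (e − 1))·j` for `j ≥ 1`, `r_out ≤ r_in`, `0 < e`
(`(j+1)·G ≤ 2j·G`, `ρ_j ≤ e − 1 ≤ (e−1)·j`). [folklore] -/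
theorem price_le_linear {e m j δ rin rout : ℤ} (he : 0 < e) (hio : rout ≤ rin) (hj : 1 ≤ j) :
    j * δ + (j + 1) * (rin - rout) + (j ^ 2 * m - j * δ - (j + 1) * rin) % e ≤ (δ + 2 * (rin - rout) + (e - 1)) * j := by
  have h1 := (gain_bounds he m j δ rin).2
  have hG : 0 ≤ rin - rout := by omega
  nlinarith

/-- **… and at least linear**: `(δ + (r_in − r_out))·j + (r_in − r_out) ≤ price_j` (`ρ_j ≥ 0`; any signs). [folklore] -/
theorem linear_le_price {e m j δ rin rout : ℤ} (he : 0 < e) :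
    (δ + (rin - rout)) * j + (rin - rout) ≤ j * δ + (j + 1) * (rin - rout) + (j ^ 2 * m - j * δ - (j + 1) * rin) % e := by
  have h0 := (gain_bounds he m j δ rin).1
  nlinarith

/-- **Hence off the slice the demand beats a linear function**: `¬ HullCellδ ⟹ (δ + G)·j + G < (j²−1)·m`. [folklore] -/
theorem linear_lt_demand_of_not_hullCellδ {e m j δ rin rout : ℤ} (he : 0 < e) (h : ¬ HullCellδ e m j δ rin rout) :
    (δ + (rin - rout)) * j + (rin - rout) < (j ^ 2 - 1) * m :=
  (linear_le_price (m := m) (j := j) (δ := δ) (rin := rin) (rout := rout) he).trans_lt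
    ((not_hullCellδ_iff_price_lt_demand e m j δ rin rout).mp h)

/-! ## §2. Sums over the labels `J+1, …, J+n` above a label `J`: prices sum to a QUADRATIC, demands to a CUBIC -/

/-- **Triangle numbers**: `2·Σ_{k<n} (J+1+k) = n·(2J+n+1)` (`= L(L+1) − J(J+1)`, `L = J+n`). [folklore] -/
theorem two_mul_sum_labels_eq (J : ℤ) (n : ℕ) :
    2 * ∑ k ∈ range n, (J + 1 + (k : ℤ)) = (n : ℤ) * (2 * J + n + 1) := by
  induction n with
  | zero => simp
  | succ n ih =>
    rw [sum_range_succ, mul_add, ih]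
    push_cast
    ring

/-- **The demand sums to a cubic**: `6·Σ_{k<n} ((J+1+k)² − 1)·m = m·((J+n)(J+n−1)(2(J+n)+5) − J(J−1)(2J+5))` — i.e. `6m·(S(L) − S(J))` with
`S(x) = x(x−1)(2x+5)/6 = Σ_{j ≤ x} (j²−1)` (abc-iut-rh2-w-1 `RH.CellWeights.sum_range_sqSubOne`, MIN-SLICE §(iv)). [folklore] -/
theorem six_mul_sum_demand_eq (J m : ℤ) (n : ℕ) :
    6 * ∑ k ∈ range n, ((J + 1 + (k : ℤ)) ^ 2 - 1) * m =
      m * ((J + n) * (J + n - 1) * (2 * (J + n) + 5) - J * (J - 1) * (2 * J + 5)) := by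
  induction n with
  | zero => simp
  | succ n ih =>
    rw [sum_range_succ, mul_add, ih]
    push_cast
    ring

/-- **THE SUMMED PRICE IS AT MOST QUADRATIC**: `2·Σ_{k<n} price_{J+1+k} ≤ (δ + 2(r_in − r_out) + (e−1))·n·(2J+n+1)` (`J ≥ 0`, `r_out ≤ r_in`,
`0 < e`) — LINEAR prices sum to a triangle number. [folklore] -/
theorem two_mul_sum_price_le {e m δ rin rout J : ℤ} (he : 0 < e) (hio : rout ≤ rin) (hJ : 0 ≤ J) (n : ℕ) :
    2 * ∑ k ∈ range n, ((J + 1 + (k : ℤ)) * δ + (J + 1 + (k : ℤ) + 1) * (rin - rout) +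
        ((J + 1 + (k : ℤ)) ^ 2 * m - (J + 1 + (k : ℤ)) * δ - (J + 1 + (k : ℤ) + 1) * rin) % e) ≤
      (δ + 2 * (rin - rout) + (e - 1)) * ((n : ℤ) * (2 * J + n + 1)) := by
  have hterm : ∀ k ∈ range n, (J + 1 + (k : ℤ)) * δ + (J + 1 + (k : ℤ) + 1) * (rin - rout) +
      ((J + 1 + (k : ℤ)) ^ 2 * m - (J + 1 + (k : ℤ)) * δ - (J + 1 + (k : ℤ) + 1) * rin) % e ≤
        (δ + 2 * (rin - rout) + (e - 1)) * (J + 1 + (k : ℤ)) := fun k _ =>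
    price_le_linear he hio (by have := Int.natCast_nonneg k; omega)
  have hsum := sum_le_sum hterm
  rw [← mul_sum] at hsum
  have hlab := two_mul_sum_labels_eq J n
  have h3 : (δ + 2 * (rin - rout) + (e - 1)) * ((n : ℤ) * (2 * J + n + 1)) =
      2 * ((δ + 2 * (rin - rout) + (e - 1)) * ∑ k ∈ range n, (J + 1 + (k : ℤ))) := by
    rw [← hlab]; ring
  linarith [hsum, h3]

/-- **… and at least quadratic**: `(δ + (r_in − r_out))·n·(2J+n+1) + 2(r_in − r_out)·n ≤ 2·Σ_{k<n} price_{J+1+k}` (`0 < e`; any signs).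
[folklore] -/
theorem sum_price_ge {e m δ rin rout J : ℤ} (he : 0 < e) (n : ℕ) :
    (δ + (rin - rout)) * ((n : ℤ) * (2 * J + n + 1)) + 2 * (rin - rout) * n ≤
      2 * ∑ k ∈ range n, ((J + 1 + (k : ℤ)) * δ + (J + 1 + (k : ℤ) + 1) * (rin - rout) +
        ((J + 1 + (k : ℤ)) ^ 2 * m - (J + 1 + (k : ℤ)) * δ - (J + 1 + (k : ℤ) + 1) * rin) % e) := by
  have hsum : ∑ k ∈ range n, ((δ + (rin - rout)) * (J + 1 + (k : ℤ)) + (rin - rout)) ≤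
      ∑ k ∈ range n, ((J + 1 + (k : ℤ)) * δ + (J + 1 + (k : ℤ) + 1) * (rin - rout) +
        ((J + 1 + (k : ℤ)) ^ 2 * m - (J + 1 + (k : ℤ)) * δ - (J + 1 + (k : ℤ) + 1) * rin) % e) :=
    sum_le_sum fun k _ => linear_le_price he
  have hlin : ∑ k ∈ range n, ((δ + (rin - rout)) * (J + 1 + (k : ℤ)) + (rin - rout)) =
      (δ + (rin - rout)) * ∑ k ∈ range n, (J + 1 + (k : ℤ)) + (rin - rout) * n := by
    rw [sum_add_distrib, mul_sum, sum_const, card_range]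
    simp [mul_comm]
  have hlab := two_mul_sum_labels_eq J n
  have h3 : (δ + (rin - rout)) * ((n : ℤ) * (2 * J + n + 1)) =
      2 * ((δ + (rin - rout)) * ∑ k ∈ range n, (J + 1 + (k : ℤ))) := by
    rw [← hlab]; ring
  linarith [hsum, hlin, h3]

/-- **THE SUMMED DEFICIT IS CUBIC MINUS QUADRATIC**: `6·Σ_{k<n} def_{J+1+k} ≥ m·((J+n)(J+n−1)(2(J+n)+5) − J(J−1)(2J+5)) − 3(δ + 2(r_in−r_out) + (e−1))·n(2J+n+1)`
(`def_j = d_j − price_j`; `J ≥ 0`, `r_out ≤ r_in`, `0 < e`). READING (§3): even crediting EVERY cell above the boundary with its full price, the conceded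
mass above `J` is the cubic demand minus a quadratic — the fraction recovered is `≤ 3(δ+2G+e−1)·n(2J+n+1)/(m·[cubic])`, `O((δ+G)/(m·l⋆))`, never `→ 1`
at a deep place. [folklore] -/
theorem six_mul_sum_deficit_ge {e m δ rin rout J : ℤ} (he : 0 < e) (hio : rout ≤ rin) (hJ : 0 ≤ J) (n : ℕ) :
    m * ((J + n) * (J + n - 1) * (2 * (J + n) + 5) - J * (J - 1) * (2 * J + 5)) -
        3 * ((δ + 2 * (rin - rout) + (e - 1)) * ((n : ℤ) * (2 * J + n + 1))) ≤
      6 * ∑ k ∈ range n, (((J + 1 + (k : ℤ)) ^ 2 - 1) * m -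
        ((J + 1 + (k : ℤ)) * δ + (J + 1 + (k : ℤ) + 1) * (rin - rout) +
          ((J + 1 + (k : ℤ)) ^ 2 * m - (J + 1 + (k : ℤ)) * δ - (J + 1 + (k : ℤ) + 1) * rin) % e)) := by
  rw [sum_sub_distrib]
  have hd := six_mul_sum_demand_eq J m n
  have h := two_mul_sum_price_le (m := m) (δ := δ) he hio hJ n
  linarith

/-- **RATIO FORM (cross-multiplied, no division): `m·[cubic]·(2·Σ price) ≤ (δ + 2G + e − 1)·n(2J+n+1)·(6·Σ demand)`** whenever `m ≥ 0` — the share of the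
demand above `J` that prices can cover is at most `3(δ+2G+e−1)·n(2J+n+1) / (m·[(J+n)(J+n−1)(2(J+n)+5) − J(J−1)(2J+5)])`. [folklore] -/
theorem sum_price_mul_le_sum_demand_mul {e m δ rin rout J : ℤ} (he : 0 < e) (hio : rout ≤ rin) (hJ : 0 ≤ J) (hm : 0 ≤ m) (n : ℕ) :
    m * ((J + n) * (J + n - 1) * (2 * (J + n) + 5) - J * (J - 1) * (2 * J + 5)) *
        (2 * ∑ k ∈ range n, ((J + 1 + (k : ℤ)) * δ + (J + 1 + (k : ℤ) + 1) * (rin - rout) +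
          ((J + 1 + (k : ℤ)) ^ 2 * m - (J + 1 + (k : ℤ)) * δ - (J + 1 + (k : ℤ) + 1) * rin) % e)) ≤
      (δ + 2 * (rin - rout) + (e - 1)) * ((n : ℤ) * (2 * J + n + 1)) *
        (6 * ∑ k ∈ range n, ((J + 1 + (k : ℤ)) ^ 2 - 1) * m) := by
  rw [six_mul_sum_demand_eq J m n]
  have hprice := two_mul_sum_price_le (m := m) (δ := δ) he hio hJ n
  -- the cubic difference is non-negative: it is `6·Σ ((J+1+k)²−1)`, a sum of non-negative terms (`J+1+k ≥ 1`)
  have hcub : 0 ≤ (J + n) * (J + n - 1) * (2 * (J + n) + 5) - J * (J - 1) * (2 * J + 5) := by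
    have h1 := six_mul_sum_demand_eq J 1 n
    rw [mul_comm (1 : ℤ), mul_one] at h1
    rw [← h1]
    refine mul_nonneg (by norm_num) (sum_nonneg fun k _ => ?_)
    rw [mul_one]
    have h2 : (0 : ℤ) ≤ J + (k : ℤ) := by have := Int.natCast_nonneg k; omega
    nlinarith [h2]
  have hm' : 0 ≤ m * ((J + n) * (J + n - 1) * (2 * (J + n) + 5) - J * (J - 1) * (2 * J + 5)) := mul_nonneg hm hcub
  calc m * ((J + n) * (J + n - 1) * (2 * (J + n) + 5) - J * (J - 1) * (2 * J + 5)) *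
        (2 * ∑ k ∈ range n, ((J + 1 + (k : ℤ)) * δ + (J + 1 + (k : ℤ) + 1) * (rin - rout) +
          ((J + 1 + (k : ℤ)) ^ 2 * m - (J + 1 + (k : ℤ)) * δ - (J + 1 + (k : ℤ) + 1) * rin) % e))
      ≤ m * ((J + n) * (J + n - 1) * (2 * (J + n) + 5) - J * (J - 1) * (2 * J + 5)) *
          ((δ + 2 * (rin - rout) + (e - 1)) * ((n : ℤ) * (2 * J + n + 1))) :=
        mul_le_mul_of_nonneg_left hprice hm'
    _ = (δ + 2 * (rin - rout) + (e - 1)) * ((n : ℤ) * (2 * J + n + 1)) *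
          (m * ((J + n) * (J + n - 1) * (2 * (J + n) + 5) - J * (J - 1) * (2 * J + 5))) := by ring

/-! ## §4. Sanity row (R-W WINDOW-TABLE integers; rh2-w-2 `rows_worked_example`) -/

/-- HEX `λ₈ @ l = 11`, `p = 7` (`e = 165`, `m = 120`, `δ = 164`, `r_in = 28`, `r_out = −281`; boundary `J = 4`, `l⋆ = 5`): at the one label above the
boundary, `j = 5`: `price = 5·164 + 6·309 + ρ₅ = 2706` (`ρ₅ = 2012 mod 165 = 32`), `demand = 24·120 = 2880`, `deficit = 174` — the R-W margin `−174`;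
and the cell is OFF there, ON at `j = 4`. [folklore] -/
theorem row_hex8_at_11 :
    (5 : ℤ) * 164 + (5 + 1) * (28 - (-281)) + ((5 : ℤ) ^ 2 * 120 - 5 * 164 - (5 + 1) * 28) % 165 = 2706 ∧
      ((5 : ℤ) ^ 2 - 1) * 120 = 2880 ∧ (2880 : ℤ) - 2706 = 174 ∧
        ¬ HullCellδ 165 120 5 164 28 (-281) ∧ HullCellδ 165 120 4 164 28 (-281) := by
  unfold HullCellδ
  decide

end Summit.ABC.IUTFork.Repair.RH.HullCellSlackSum
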